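import Summits.NavierStokesRegularity.NavierStokesRegularity.Theorems.CorkscrewDynamoCorkscrewProfileCorotatingFrame
import Literature.Analysis.FluidPDE.PineauVicolRDSSLeray
import HarnessLib

/-!
# Route CorkscrewDynamo · crux `CorkscrewProfile` (stmt-NavierStokesRegularity-11282) — tool stub T8: the profile equation of a rotating wave of Leray's backward system

Tool stub `stub_rotatingWaveProfileEq` of line `registered` (skeleton v11, lead c5, wave 2): if the
rotating wave `W(s, y) = R_{αs} U(R_{−αs} y)` (`R_θ = rotZ θ` the rotation about `e₃`,
`J = rotGen` its generator) with a smooth profile `U` is a classical solution of Leray's backward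
self-similar Navier–Stokes system `∂ₛW + ½W + ½DW[y] + DW[W] + ∇P = ΔW` on all of `ℝ × ℝ³`
(`IsBackwardLeraySolutionOn univ 1 W P`), then differentiating in `s` at `s = 0`
(`∂ₛW(0, y) = α (J U(y) − DU(y)[J y])`, `W(0, ·) = U`) gives PERELMAN'S ROTATED PROFILE SYSTEM
`α (J U − DU[J y]) + ½U + ½DU[y] − ΔU + DU[U] + ∇P(0) = 0` for `(U, P 0)`. This is the converse
direction of the co-rotating frame dictionary `stub_corotatingFrame`
(`CorkscrewDynamoCorkscrewProfileCorotatingFrame`), whose calculus (`hasDerivAt_rotZ_comp`,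
`rotZ_neg_smul_add_smul_rotGen`) is reused verbatim.
-/

noncomputable section

open MeasureTheory Set Function Filter Topology InnerProductSpace Metric
open Literature.Analysis.FluidPDE Literature.Analysis.FluidPDE.PineauVicol2026
open scoped RealInnerProductSpace Laplacian ContDiff NNReal ENNReal

namespace Summit.NavierStokesRegularity.NavierStokesRegularity.Theorems.CorkscrewProfile.Birth

set_option linter.dupNamespace false

/-- The time derivative of the rotating wave `s ↦ R_{αs} U(R_{−αs} y)` at `s = 0` is
`α (J U(y) − DU(y)[J y])` (chain rule `d/ds [R_{θ(s)} w(s)] = R_θ w' + θ' J R_θ w`,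
`hasDerivAt_rotZ_comp`, with `R_0 = id`). [folklore] -/
theorem hasDerivAt_rotatingWave_zero {α : ℝ}
    {U : EuclideanSpace ℝ (Fin 3) → EuclideanSpace ℝ (Fin 3)} (hUd : Differentiable ℝ U)
    (y : EuclideanSpace ℝ (Fin 3)) :
    HasDerivAt (fun t => rotZ (α * t) (U (rotZ (-(α * t)) y)))
      (α • (rotGen (U y) - fderiv ℝ U y (rotGen y))) 0 := by
  have hθ₁ : HasDerivAt (fun t : ℝ => α * t) α 0 := by
    simpa using (hasDerivAt_id (0 : ℝ)).const_mul α
  have hθ₂ : HasDerivAt (fun t : ℝ => -(α * t)) (-α) 0 := hθ₁.neg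
  have hzd : HasDerivAt (fun t => rotZ (-(α * t)) y) ((-α) • rotGen y) 0 := by
    have h := hasDerivAt_rotZ_comp hθ₂ (hasDerivAt_const (0 : ℝ) y)
    refine h.congr_deriv ?_
    rw [mul_zero, neg_zero, rotZ_zero, rotZ_zero, zero_add]
  have hwd : HasDerivAt (fun t => U (rotZ (-(α * t)) y)) (fderiv ℝ U y ((-α) • rotGen y)) 0 := by
    have h := (hUd (rotZ (-(α * 0)) y)).hasFDerivAt.comp_hasDerivAt (0 : ℝ) hzd
    rw [mul_zero, neg_zero, rotZ_zero] at h
    exact h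
  have h := hasDerivAt_rotZ_comp hθ₁ hwd
  refine h.congr_deriv ?_
  rw [ContinuousLinearMap.map_smul, rotZ_neg_smul_add_smul_rotGen, mul_zero, neg_zero, rotZ_zero,
    rotZ_zero]

/-- **The profile equation of a rotating wave** (tool stub `stub_rotatingWaveProfileEq` of the
birth line of `CorkscrewDynamo.CorkscrewProfile`). If `U` is smooth and the rotating wave
`W(s, y) = R_{αs} U(R_{−αs} y)` together with the pressure `P` is a classical solution of Leray's
backward system `∂ₛW + ½W + ½DW[y] + DW[W] + ∇P = ΔW`, `div W = 0` on `ℝ × ℝ³`, then `(U, P(0))`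
solves Perelman's rotated profile system
`α (J U − DU[J y]) + ½U + ½DU[y] − ΔU + DU[U] + ∇P(0) = 0` (`J v = e₃ × v = rotGen v`):
Leray's momentum equation at `s = 0` (`IsBackwardLeraySolutionOn.momentum_leray`), where
`W(0, ·) = U` and `∂ₛW(0, y) = α (J U(y) − DU(y)[J y])` (`hasDerivAt_rotatingWave_zero`). [folklore] -/
theorem stub_rotatingWaveProfileEq {α : ℝ}
    {U : EuclideanSpace ℝ (Fin 3) → EuclideanSpace ℝ (Fin 3)} {P : ℝ → EuclideanSpace ℝ (Fin 3) → ℝ}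
    (hU : ContDiff ℝ (⊤ : ℕ∞) U)
    (hL : IsBackwardLeraySolutionOn Set.univ 1 (fun s y => rotZ (α * s) (U (rotZ (-(α * s)) y))) P) :
    ∀ y : EuclideanSpace ℝ (Fin 3),
      α • (rotGen (U y) - fderiv ℝ U y (rotGen y)) + (1 / 2 : ℝ) • U y + (1 / 2 : ℝ) • fderiv ℝ U y y
        - (Δ U) y + fderiv ℝ U y (U y) + gradient (P 0) y = 0 := by
  intro y
  have hUd : Differentiable ℝ U := hU.differentiable (by simp)
  -- Leray's momentum equation of the wave at `s = 0`
  have hm := hL.momentum_leray (Set.mem_univ (0 : ℝ)) y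
  -- the time derivative of the wave at `s = 0`
  have htd : timeDerivWithin univ (fun s y => rotZ (α * s) (U (rotZ (-(α * s)) y))) 0 y =
      α • (rotGen (U y) - fderiv ℝ U y (rotGen y)) := by
    rw [timeDerivWithin_eq_deriv isOpen_univ (mem_univ (0 : ℝ))]
    exact (hasDerivAt_rotatingWave_zero hUd y).deriv
  -- the slice of the wave at `s = 0` is the profile
  have hW0 : (fun z => rotZ (α * 0) (U (rotZ (-(α * 0)) z))) = U := by
    funext z
    rw [mul_zero, neg_zero, rotZ_zero, rotZ_zero]
  beta_reduce at hm
  rw [htd, hW0, convect_apply, one_smul, mul_zero, neg_zero, rotZ_zero, rotZ_zero] at hm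
  rw [← hm]
  abel

end Summit.NavierStokesRegularity.NavierStokesRegularity.Theorems.CorkscrewProfile.Birth
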